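import Mathlib
import HarnessLib
import Summits.HubbardSuperconductivity.HubbardSuperconductivity.Theorems.KLProgrammeKLRegimeSplitTwoLegSizesMSOfCurveJet
import Summits.HubbardSuperconductivity.HubbardSuperconductivity.Theorems.KLProgrammeKLRegimeCountertermJacksonFrameDeriv

/-!
# K3 under scheme F (K3-FLOW RULING, plan g16 KL STATUS l.2548): the (I-F jets) of a JACKSON FLOW PIECE from the READING JETS —
# `‖Dʲ evalM (jacksonFrame d (klFrameExtFn μ ν_n(K)))‖ ≤ curveJetBar (curveExtC X c) (curveExtC X c') U j n` for every frame `K`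

Cell gate-hubbard-kl, seat hubbard-kl-k3c3-p3 (g5; S4(b) of the ruling: «`flowPieceJets_step` … k3c3-p3: this is where your
`norm_iteratedFDeriv_onM_klFrameExtFn_le_curveJetBar`/Jackson machinery goes now»).  In the flowing-dispersion family (p2's V17F draft §0/§3/§4) the
scale-`n` frame piece is `klFlowPiece n = jacksonFrame (klFlowDeg n) (klFrameExtFn μ (ν_n(K_n)))` — the Jackson mean of the tube extension of the
scale-`n` local part read on the flow frame's own curve —, the engine supplies (E3a-F) `TwoLegReadJetsF … n` (`ν_n(K_n)` is `C⁴` with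
`|∂_θ^k ν_n(K_n)| ≤ curveJetBar G.S Q.S' U k n`, `k ≤ 4`), and the renormalisation child must prove (I-F jets) `FlowPieceJetsAt … R n`
(`‖Dʲ evalM (klFlowPiece n)‖ ≤ R.Gfr j·uPow j U·4^{(j−2)n}`, `j ≤ 4`).  This file proves the step SCHEME-GENERICALLY (for every frame `K`, every degree
`d`), so that the V17F stub is a one-line instance the hour the bundle lands:

* §1 `klFrameExtFn_localPart_symmetric` — the extension of `ν_n(K)` is a symmetric frame (unconditional `D₄`-symmetries of
  `klLocalPart`) and continuous;
* §2 **`norm_iteratedFDeriv_evalM_jacksonFrame_klFrameExtFn_le_curveJetBar`** — reading jets `|∂^k ν_n(K)| ≤ curveJetBar c c' U k n` (`k ≤ 4`, `ν_n(K)`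
  `C⁴`) ⇒ `‖Dʲ evalM (jacksonFrame d (klFrameExtFn μ (ν_n(K)))) q‖ ≤ curveJetBar (curveExtC X c) (curveExtC X c') U j n` (`j ≤ 4`): p520144's chain rule
  (`norm_iteratedFDeriv_onM_klFrameExtFn_le_curveJetBar`) followed by k3c3-p2's (J2) `norm_iteratedFDeriv_eval_jacksonFrame_le` (the Jackson mean passes
  sup bounds of every derivative with constant ONE, uniformly in `d`); also the `ContDiff ℝ 4` of the smoothed piece;
* §3 **`norm_iteratedFDeriv_evalM_jacksonFrame_klFrameExtFn_le_pieceBar`** — the FIT: under `curveExtC X c j + curveExtC X c' j·|U| ≤ R.Gfr j` (`j ≤ 4`)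
  the smoothed piece is within the admissible piece bar `R.Gfr j·uPow j U·4^{(j−2)n}` (dischargeable in `CountertermP2`'s quantifier order: `R` after `G`,
  `U₀` after `Q`).

Proofs only; nothing about the model is asserted.  References: BGM 2006 §2.2 (2.23), §2.4 (2.36) [cite: BenfattoGiulianiMastropietro2006].
-/

noncomputable section

namespace Summit.HubbardSuperconductivity.HubbardSuperconductivity.Theorems.KLRegimeSplit

set_option linter.dupNamespace false -- summit = problem name (single-conjunct summit), D-0017

open Real Finset MeasureTheory Literature.MathematicalPhysics.QuantumLattice Literature.MathematicalPhysics.QuantumLattice.FermiRG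
open Literature.Probability.LatticeModels
open Summit.HubbardSuperconductivity.HubbardSuperconductivity.Theorems.PerturbedFermiCurve

/-! ## §1 The extension of a local part is a continuous symmetric frame -/

/-- A frame whose `onM` is `Cᵐ` is continuous as a function on `Fin 2 → ℝ` (local copy of …CountertermJacksonSelfMap's lemma, light imports). -/
private theorem continuous_of_contDiff_onM_fn {P : FrameFn} {m : WithTop ℕ∞} (h : ContDiff ℝ m (onM P)) : Continuous P := by
  have hK : P = fun p : Fin 2 → ℝ => onM P (WithLp.toLp 2 p) := by funext p; simp [onM]
  rw [hK]
  exact h.continuous.comp (PiLp.continuous_toLp 2 _)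

section Model

variable {L M : ℕ} [NeZero L] [NeZero M]

/-- **The tube extension of the scale-`n` local part of ANY frame is a symmetric frame** (`μ ∈ klWindowC`): the profile `ν_n(K)` is `2π`-periodic, even and
`(π/2 − ·)`-invariant unconditionally. -/
theorem klFrameExtFn_localPart_symmetric (β U μ : ℝ) (K : TrigPolyC4v) (n : ℕ) (hμ : μ ∈ klWindowC) :
    IsSymmetricFrame (klFrameExtFn μ (klLocalPart L M β U μ K n)) := by
  have hμ' := hμ
  simp only [klWindowC, Set.mem_Icc] at hμ'
  exact isSymmetricFrame_klFrameExtFn (klLocalPart_periodic β U μ K n) (klLocalPart_neg β U μ K n) (klLocalPart_pi_div_two_sub β U μ K n)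
    (by linarith)

/-! ## §2 Reading jets ⇒ jets of the Jackson-smoothed extension -/

/-- **(E3a-F) ⇒ (I-F jets), scheme-generic.**  For every frame `K`, scale `n`, degree `d`: if `ν := ν_n(K)` is `C⁴` with
`|∂_θ^k ν| ≤ curveJetBar c c' U k n` (`k ≤ 4`, nonnegative constants) then, for `j ≤ 4` and every `q`,
`‖Dʲ evalM (jacksonFrame d (klFrameExtFn μ ν)) q‖ ≤ curveJetBar (curveExtC X c) (curveExtC X c') U j n`, and the smoothed piece is `C⁴`. -/
theorem norm_iteratedFDeriv_evalM_jacksonFrame_klFrameExtFn_le_curveJetBar {c c' : ℕ → ℝ} (hc : ∀ k, 0 ≤ c k) (hc' : ∀ k, 0 ≤ c' k)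
    {β U μ : ℝ} (hμ : μ ∈ klWindowC) {K : TrigPolyC4v} {n : ℕ} (hν : ContDiff ℝ 4 (klLocalPart L M β U μ K n))
    (hjet : ∀ k ≤ 4, ∀ θ : ℝ, |iteratedDeriv k (klLocalPart L M β U μ K n) θ| ≤ curveJetBar c c' U k n)
    {X : ℝ} (hX : ∀ l ≤ 4, ∀ x : ℝ, ‖iteratedFDeriv ℝ l salmhoferCutoff x‖ ≤ X) (d : ℕ) :
    ContDiff ℝ 4 (evalM (jacksonFrame d (klFrameExtFn μ (klLocalPart L M β U μ K n)))) ∧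
      ∀ j ≤ 4, ∀ q : Momentum,
        ‖iteratedFDeriv ℝ j (evalM (jacksonFrame d (klFrameExtFn μ (klLocalPart L M β U μ K n)))) q‖ ≤
          curveJetBar (curveExtC X c) (curveExtC X c') U j n := by
  set F : FrameFn := klFrameExtFn μ (klLocalPart L M β U μ K n) with hF
  have hper := klLocalPart_periodic (L := L) (M := M) β U μ K n
  -- the extension: `C⁴` with the curve-jet sizes (p520144)
  have hcd : ContDiff ℝ 4 (onM F) := contDiff_four_onM_of_profile hν hper hμ hF
  have hsize : ∀ i ≤ 4, ∀ x : Momentum, ‖iteratedFDeriv ℝ i (onM F) x‖ ≤ curveJetBar (curveExtC X c) (curveExtC X c') U i n :=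
    fun i hi x => norm_iteratedFDeriv_onM_klFrameExtFn_le_curveJetBar hc hc' hν hper hjet hμ hX hF hi x
  -- the Jackson mean passes both with constant one (k3c3-p2 (J2))
  have hsym : IsSymmetricFrame F := klFrameExtFn_localPart_symmetric β U μ K n hμ
  obtain ⟨hperF, hreflF, hswapF⟩ := hsym
  have hcontF : Continuous F := continuous_of_contDiff_onM_fn hcd
  have hG : ContDiff ℝ 4 (fun x : EuclideanSpace ℝ (Fin 2) => F (WithLp.ofLp x)) := hcd
  have h := norm_iteratedFDeriv_eval_jacksonFrame_le (d := d) hcontF hperF hreflF hswapF (m := 4) hG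
    (B := fun i => curveJetBar (curveExtC X c) (curveExtC X c') U i n) hsize
  exact ⟨h.1, h.2⟩

/-! ## §3 The fit against the admissible piece bar -/

/-- **The package FIT**: `curveExtC X c j + curveExtC X c' j·|U| ≤ R.Gfr j` puts the curve-jet bar inside the admissible piece bar. -/
theorem curveJetBar_curveExtC_le_pieceBar {c c' : ℕ → ℝ} {X : ℝ} {R : RenConsts} {U : ℝ} {j : ℕ}
    (hfit : curveExtC X c j + curveExtC X c' j * |U| ≤ R.Gfr j) (n : ℕ) :
    curveJetBar (curveExtC X c) (curveExtC X c') U j n ≤ R.Gfr j * uPow j U * (4 : ℝ) ^ (((j : ℤ) - 2) * n) := by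
  rw [curveJetBar_apply]
  have h2 := uPow_nonneg' j U
  have h3 : (0 : ℝ) ≤ (4 : ℝ) ^ (((j : ℤ) - 2) * n) := zpow_nonneg (by norm_num) _
  exact mul_le_mul_of_nonneg_right (mul_le_mul_of_nonneg_right hfit h2) h3

/-- **(E3a-F) ⇒ (I-F jets) WITH THE FIT, scheme-generic**: reading jets within `curveJetBar c c' U k n` and the five inequalities
`curveExtC X c j + curveExtC X c' j·|U| ≤ R.Gfr j` (`j ≤ 4`) give `‖Dʲ evalM (jacksonFrame d (klFrameExtFn μ ν_n(K))) q‖ ≤ R.Gfr j·uPow j U·4^{(j−2)n}`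
for every `j ≤ 4`, `q`, frame `K` and degree `d` — the text of `FlowPieceJetsAt` at `K := K_n`, `d := klFlowDeg n`. -/
theorem norm_iteratedFDeriv_evalM_jacksonFrame_klFrameExtFn_le_pieceBar {c c' : ℕ → ℝ} (hc : ∀ k, 0 ≤ c k) (hc' : ∀ k, 0 ≤ c' k)
    {β U μ : ℝ} (hμ : μ ∈ klWindowC) {K : TrigPolyC4v} {n : ℕ} (hν : ContDiff ℝ 4 (klLocalPart L M β U μ K n))
    (hjet : ∀ k ≤ 4, ∀ θ : ℝ, |iteratedDeriv k (klLocalPart L M β U μ K n) θ| ≤ curveJetBar c c' U k n)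
    {X : ℝ} (hX : ∀ l ≤ 4, ∀ x : ℝ, ‖iteratedFDeriv ℝ l salmhoferCutoff x‖ ≤ X) {R : RenConsts}
    (hfit : ∀ j ≤ 4, curveExtC X c j + curveExtC X c' j * |U| ≤ R.Gfr j) (d : ℕ) {j : ℕ} (hj : j ≤ 4) (q : Momentum) :
    ‖iteratedFDeriv ℝ j (evalM (jacksonFrame d (klFrameExtFn μ (klLocalPart L M β U μ K n)))) q‖ ≤
      R.Gfr j * uPow j U * (4 : ℝ) ^ (((j : ℤ) - 2) * n) :=
  ((norm_iteratedFDeriv_evalM_jacksonFrame_klFrameExtFn_le_curveJetBar hc hc' hμ hν hjet hX d).2 j hj q).trans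
    (curveJetBar_curveExtC_le_pieceBar (hfit j hj) n)

/-- **The same at the package fields** (`TwoLegReadJetsF`'s currency `curveJetBar G.S Q.S'`): fit `curveExtC X G.S j + curveExtC X Q.S' j·|U| ≤ R.Gfr j`. -/
theorem norm_iteratedFDeriv_evalM_jacksonFrame_klFrameExtFn_le_pieceBar_GQ {G : GeoConsts} {Q : EngConsts} (hS : ∀ k, 0 ≤ G.S k)
    (hS' : ∀ k, 0 ≤ Q.S' k) {β U μ : ℝ} (hμ : μ ∈ klWindowC) {K : TrigPolyC4v} {n : ℕ} (hν : ContDiff ℝ 4 (klLocalPart L M β U μ K n))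
    (hjet : ∀ k ≤ 4, ∀ θ : ℝ, |iteratedDeriv k (klLocalPart L M β U μ K n) θ| ≤ curveJetBar G.S Q.S' U k n)
    {X : ℝ} (hX : ∀ l ≤ 4, ∀ x : ℝ, ‖iteratedFDeriv ℝ l salmhoferCutoff x‖ ≤ X) {R : RenConsts}
    (hfit : ∀ j ≤ 4, curveExtC X G.S j + curveExtC X Q.S' j * |U| ≤ R.Gfr j) (d : ℕ) {j : ℕ} (hj : j ≤ 4) (q : Momentum) :
    ‖iteratedFDeriv ℝ j (evalM (jacksonFrame d (klFrameExtFn μ (klLocalPart L M β U μ K n)))) q‖ ≤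
      R.Gfr j * uPow j U * (4 : ℝ) ^ (((j : ℤ) - 2) * n) :=
  norm_iteratedFDeriv_evalM_jacksonFrame_klFrameExtFn_le_pieceBar hS hS' hμ hν hjet hX hfit d hj q

/-- **Threshold form of the fit** (how `CountertermP2`'s quantifier order discharges it): if `R.Gfr j ≥ 2·curveExtC X c j` (the choice of `R` after `G`)
and `curveExtC X c' j·|U| ≤ curveExtC X c j` (the choice of `U₀` after `Q`; e.g. `|U| ≤ min_j curveExtC X c j / curveExtC X c' j`), then the fit holds. -/
theorem fit_of_thresholds {c c' : ℕ → ℝ} {X : ℝ} {R : RenConsts} {U : ℝ} {j : ℕ} (hR : 2 * curveExtC X c j ≤ R.Gfr j)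
    (hU : curveExtC X c' j * |U| ≤ curveExtC X c j) : curveExtC X c j + curveExtC X c' j * |U| ≤ R.Gfr j := by
  linarith

end Model

end Summit.HubbardSuperconductivity.HubbardSuperconductivity.Theorems.KLRegimeSplit

end
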